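import Summits.ResolutionOfSingularities.ResolutionOfSingularities.Theorems.WildConesConeExitFaceDictionary
import Summits.ResolutionOfSingularities.ResolutionOfSingularities.Theorems.WildConesConeExitNearDirection
import Summits.ResolutionOfSingularities.ResolutionOfSingularities.Theorems.WildConesConeExitChern
import Summits.ResolutionOfSingularities.ResolutionOfSingularities.Theorems.WildConesConeExitCriticalPlane
import Summits.ResolutionOfSingularities.ResolutionOfSingularities.Theorems.WildConesConeExitGradientOnPlane
import Summits.ResolutionOfSingularities.ResolutionOfSingularities.Theorems.WildConesConeExitFaceToPlane
import Summits.ResolutionOfSingularities.ResolutionOfSingularities.Theorems.WildConesConeExitPlaneCriterion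
import HarnessLib

/-!
# `WildCones.ConeExit` (stmt-ResolutionOfSingularities-16883): the one-step cone exit lemma — closing file

Route `ResolutionOfSingularities/WildCones`, crux #3, line `critical-plane` (lead's reshaped skeleton, seven
stubs, all landed as `Theorems/WildConesConeExit<Stub>.lean`). This file assembles them into

`ConeExit_proof : Summit.ResolutionOfSingularities.ResolutionOfSingularities.Theses.WildCones.ConeExit`:

for `p` an odd prime, `n ≥ 3`, `κ` perfect of characteristic `p`: if a state `c` of the point-blow-up dynamics
of the height-one atom `zᵖ = a(u₁ … uₙ)` has multiplicity `p` and a successor `step i τ c` is ISOLATED of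
multiplicity `p`, then `c` has cleaned order exactly `p` (`OrdP`) and its cone-invariance space is a line
(`dL c = 1`). The route decl unfolds definitionally onto the mirrored calculus of
`Theorems/ConeExit/Negative/Mirror.lean` (`crux_iff`), over which the stubs are typed.

Proof (the composition of `Cruxes/ConeExit/Lines/critical_plane.lean`):

* Case A (`caseA`): if no cleaned coefficient of degree `p` is non-zero, the cone vanishes, so by the chart
  dictionary (`stub_faceDictionary`) every face coefficient of the successor vanishes; on the coordinate
  plane `(e_j, e_j')` (`j ≠ j'`, both `≠ i`, by `n ≥ 3`) the transfer stub (`stub_faceToPlane`, `P = 0`)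
  kills `∂_k` (`k ≠ i`) and gives `∂ᵢ` constant term `c'(eᵢ) = 0` (multiplicity `p` of the successor), and
  the plane criterion (`stub_planeCriterion`) contradicts isolatedness.
* Near direction (`nearDirection`): by the dictionary and multiplicity `p` of the successor the face
  coefficients of the translated cone vanish in degrees `1 … p-1`, so `w = update τ i 1 ∈ L(a_p)`
  (`stub_nearDirection'`); as `w i = 1 ≠ 0`, `1 ≤ dL`.
* Cone forcing (`coneForcing`): if `dL ≥ 2`, the critical plane exists (`stub_criticalPlane` fed with the
  Chern / Euler–Koszul lemma `stub_chern`), the gradient of the translated cone dies on it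
  (`stub_gradientOnPlane`), hence by the dictionary and the transfer stub the successor's Jacobian dies on
  it modulo the non-unit `∂ᵢ`, and the plane criterion contradicts isolatedness; so `dL ≤ 1`.

Hypotheses `Isol c` and `PerfectField κ` of the crux are not used (refuter's mutation finding; both are
genuine but harmless strengthenings, cf. `Cruxes/ConeExit/Disproof.lean` §3).
-/

noncomputable section

-- single-problem summit: the doubled namespace component `ResolutionOfSingularities` is forced
set_option linter.dupNamespace false

open Summit.ResolutionOfSingularities.ResolutionOfSingularities.Theses.WildCones (ConeExit)
open Summit.ResolutionOfSingularities.ResolutionOfSingularities.Theorems.ConeExit.Negative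
  (clean bl ord dv tr step ser pd jac cone Linv dL)
open scoped BigOperators

namespace Summit.ResolutionOfSingularities.ResolutionOfSingularities.Theorems.WildConesConeExit

/-! ## Glue lemmas -/

section Glue

variable {n : ℕ} {κ : Type} [Field κ] (p : ℕ)

/-- Cleaning is idempotent. [folklore] -/
theorem clean_clean (c : (Fin n → ℕ) → κ) : clean p (clean p c) = clean p c := by
  funext A
  unfold clean
  by_cases h : ∀ j, p ∣ A j
  · rw [if_pos h, if_pos h]
  · rw [if_neg h, if_neg h]

/-- A step of the dynamics is already cleaned. [folklore] -/
theorem clean_step (i : Fin n) (τ : Fin n → κ) (c : (Fin n → ℕ) → κ) :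
    clean p (step p i τ c) = step p i τ c := by
  unfold step
  exact clean_clean p _

/-- Multiplicity `p ≥ 2` of a (cleaned) successor kills its coefficient at `eᵢ` (degree `1 < p`).
[folklore] -/
theorem step_single_eq_zero (hp : p.Prime) (i : Fin n) (τ : Fin n → κ) (c : (Fin n → ℕ) → κ)
    (hM' : (∃ A, clean p (step p i τ c) A ≠ 0) ∧
      ∀ A, clean p (step p i τ c) A ≠ 0 → p ≤ Finset.sum Finset.univ (fun j => A j)) :
    step p i τ c (Pi.single i 1) = 0 := by
  by_contra h
  have h' : clean p (step p i τ c) (Pi.single i 1) ≠ 0 := by rwa [clean_step]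
  have hle := hM'.2 _ h'
  have hsum : Finset.sum Finset.univ (fun j => (Pi.single i 1 : Fin n → ℕ) j) = 1 := by
    rw [Finset.sum_pi_single']
    simp
  rw [hsum] at hle
  exact absurd hle (by have := hp.two_le; omega)

/-- If no cleaned coefficient of degree exactly `p` is non-zero, the cone vanishes. [folklore] -/
theorem cone_eq_zero_of_not_ordP (c : (Fin n → ℕ) → κ)
    (h : ¬ ∃ A, clean p c A ≠ 0 ∧ Finset.sum Finset.univ (fun j => A j) = p) :
    cone p c = 0 := by
  unfold cone
  refine Finset.sum_eq_zero (fun A _ => ?_)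
  by_cases hA : Finset.sum Finset.univ (fun j => A j) = p
  · rw [if_pos hA]
    have : clean p c A = 0 := by
      by_contra hne
      exact h ⟨A, hne, hA⟩
    rw [this, map_zero]
  · rw [if_neg hA]

/-- In `Fin n` with `n ≥ 3` there are two distinct indices both different from a given `i`.
[folklore] -/
theorem exists_pair_ne (hn : 3 ≤ n) (i : Fin n) : ∃ j j' : Fin n, j ≠ j' ∧ j ≠ i ∧ j' ≠ i := by
  have h0 : (0 : ℕ) < n := by omega
  have h1 : (1 : ℕ) < n := by omega
  have h2 : (2 : ℕ) < n := by omega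
  by_cases hi0 : i = ⟨0, h0⟩
  · exact ⟨⟨1, h1⟩, ⟨2, h2⟩, by simp [Fin.ext_iff], by simp [hi0, Fin.ext_iff], by simp [hi0, Fin.ext_iff]⟩
  · by_cases hi1 : i = ⟨1, h1⟩
    · exact ⟨⟨0, h0⟩, ⟨2, h2⟩, by simp [Fin.ext_iff], by simp [hi1, Fin.ext_iff], by simp [hi1, Fin.ext_iff]⟩
    · exact ⟨⟨0, h0⟩, ⟨1, h1⟩, by simp [Fin.ext_iff], Ne.symm hi0, Ne.symm hi1⟩

/-- If some non-zero `v` lies in the cone-invariance space then `1 ≤ dL`. [folklore] -/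
theorem one_le_dL_of_mem {c : (Fin n → ℕ) → κ} {v : Fin n → κ} (hv : v ∈ Linv p c)
    (hv0 : v ≠ 0) : 1 ≤ dL p c := by
  unfold dL
  calc 1 = Module.finrank κ (Submodule.span κ ({v} : Set (Fin n → κ))) :=
        (finrank_span_singleton hv0).symm
    _ ≤ Module.finrank κ (Submodule.span κ (Linv p c)) :=
        Submodule.finrank_mono (Submodule.span_mono (Set.singleton_subset_iff.mpr hv))

end Glue

/-! ## The three clauses -/

/-- **Case A**: multiplicity `p` at `c` and an ISOLATED successor of multiplicity `p` force cleaned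
order EXACTLY `p`. [cite: CossartJannsenSaito2020, Lemma 6.33] -/
theorem caseA :
    ∀ (p : ℕ), p.Prime → ∀ (n : ℕ), 3 ≤ n → ∀ (κ : Type) [Field κ] [CharP κ p]
      (c : (Fin n → ℕ) → κ) (i : Fin n) (τ : Fin n → κ),
      ((∃ A, clean p c A ≠ 0) ∧ ∀ A, clean p c A ≠ 0 → p ≤ Finset.sum Finset.univ (fun j => A j)) →
      Module.Finite κ (MvPowerSeries (Fin n) κ ⧸ jac p (step p i τ c)) →
      ((∃ A, clean p (step p i τ c) A ≠ 0) ∧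
        ∀ A, clean p (step p i τ c) A ≠ 0 → p ≤ Finset.sum Finset.univ (fun j => A j)) →
      ∃ A, clean p c A ≠ 0 ∧ Finset.sum Finset.univ (fun j => A j) = p := by
  intro p hp n hn κ _ _ c i τ hM hI' hM'
  by_contra hO
  have hcone : cone p c = 0 := cone_eq_zero_of_not_ordP p c hO
  -- face coefficients of the successor vanish (dictionary with cone = 0)
  have hface : ∀ B : Fin n → ℕ, B i = 0 → clean p (step p i τ c) B =
      if (∀ j, p ∣ B j) then 0 else
        MvPolynomial.coeff (Finsupp.equivFunOnFinite.symm B) (0 : MvPolynomial (Fin n) κ) := by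
    intro B hB
    rw [clean_step, stub_faceDictionary p n κ c i τ B hM hB, hcone, map_zero]
  obtain ⟨j, j', hjj', hji, hj'i⟩ := exists_pair_ne hn i
  -- the coordinate plane (e_j, e_j') inside {v_i = 0}
  let ĉ : Fin n → κ := fun m => if m = j then 1 else 0
  let ℓ : Fin n → κ := fun m => if m = j' then 1 else 0
  have hci : ĉ i = 0 := by simp [ĉ, Ne.symm hji]
  have hℓi : ℓ i = 0 := by simp [ℓ, Ne.symm hj'i]
  have hdet : ĉ j * ℓ j' - ĉ j' * ℓ j ≠ 0 := by
    simp [ĉ, ℓ, hjj', Ne.symm hjj']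
  obtain ⟨hvan, hconst⟩ := stub_faceToPlane p hp n κ (step p i τ c) i 0 κ ĉ ℓ hci hℓi hface
  have hvan0 : ∀ k : Fin n, k ≠ i →
      MvPowerSeries.subst (fun m : Fin n => MvPowerSeries.C (ĉ m) * MvPowerSeries.X (0 : Fin 2) +
        MvPowerSeries.C (ℓ m) * MvPowerSeries.X 1) (pd k (ser p (step p i τ c))) = 0 := by
    intro k hk
    rw [hvan k hk, map_zero, map_zero, MvPolynomial.coe_zero]
  have hconst0 : MvPowerSeries.constantCoeff (MvPowerSeries.subst
      (fun m : Fin n => MvPowerSeries.C (ĉ m) * MvPowerSeries.X (0 : Fin 2) +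
        MvPowerSeries.C (ℓ m) * MvPowerSeries.X 1) (pd i (ser p (step p i τ c)))) = 0 := by
    rw [hconst, clean_step, step_single_eq_zero p hp i τ c hM', map_zero]
  exact stub_planeCriterion p n κ (step p i τ c) i κ ĉ ℓ j j' hdet hvan0 hconst0 hI'

/-- **Near direction**: multiplicity `p` at `c` and a multiplicity-`p` successor in chart `i` at
translation `τ` force `update τ i 1 ∈ L(a_p)`. [cite: Hironaka1970AdditiveGroups, Thm 2] -/
theorem nearDirection :
    ∀ (p : ℕ), p.Prime → ∀ (n : ℕ) (κ : Type) [Field κ] [CharP κ p]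
      (c : (Fin n → ℕ) → κ) (i : Fin n) (τ : Fin n → κ),
      ((∃ A, clean p c A ≠ 0) ∧ ∀ A, clean p c A ≠ 0 → p ≤ Finset.sum Finset.univ (fun j => A j)) →
      ((∃ A, clean p (step p i τ c) A ≠ 0) ∧
        ∀ A, clean p (step p i τ c) A ≠ 0 → p ≤ Finset.sum Finset.univ (fun j => A j)) →
      Function.update τ i 1 ∈ Linv p c := by
  intro p hp n κ _ _ c i τ hM hM'
  refine stub_nearDirection' p hp n κ c i τ (fun B hBi hB0 hBp => ?_)
  have hnd : ¬ ∀ j, p ∣ (B : Fin n → ℕ) j := by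
    intro hdiv
    apply hB0
    ext j
    have hj : B j ≤ Finset.sum Finset.univ (fun j => B j) :=
      Finset.single_le_sum (fun _ _ => Nat.zero_le _) (Finset.mem_univ j)
    have : B j < p := lt_of_le_of_lt hj hBp
    exact Nat.eq_zero_of_dvd_of_lt (hdiv j) this
  have hdict := stub_faceDictionary p n κ c i τ B hM hBi
  rw [if_neg hnd, Finsupp.equivFunOnFinite_symm_coe] at hdict
  rw [← hdict]
  by_contra hne
  have h' : clean p (step p i τ c) B ≠ 0 := by rwa [clean_step]
  have := hM'.2 _ h'
  omega

/-- **Cone forcing**: multiplicity `p` at `c`, an isolated multiplicity-`p` successor and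
`w = update τ i 1 ∈ L` force `dL ≤ 1`. [cite: Jouanolou1979, Ch. 1] -/
theorem coneForcing :
    ∀ (p : ℕ), p.Prime → p ≠ 2 → ∀ (n : ℕ), 3 ≤ n → ∀ (κ : Type) [Field κ] [CharP κ p]
      (c : (Fin n → ℕ) → κ) (i : Fin n) (τ : Fin n → κ),
      ((∃ A, clean p c A ≠ 0) ∧ ∀ A, clean p c A ≠ 0 → p ≤ Finset.sum Finset.univ (fun j => A j)) →
      Module.Finite κ (MvPowerSeries (Fin n) κ ⧸ jac p (step p i τ c)) →
      ((∃ A, clean p (step p i τ c) A ≠ 0) ∧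
        ∀ A, clean p (step p i τ c) A ≠ 0 → p ≤ Finset.sum Finset.univ (fun j => A j)) →
      Function.update τ i 1 ∈ Linv p c → dL p c ≤ 1 := by
  intro p hp hp2 n hn κ _ _ c i τ hM hI' hM' hw
  by_contra hd
  have hd2 : 2 ≤ dL p c := by omega
  have hw1 : Function.update τ i (1 : κ) i = 1 := Function.update_self i 1 τ
  obtain ⟨ĉ, ℓ, j, j', hcrit, hℓ, hci, hℓi, hdet⟩ :=
    stub_criticalPlane stub_chern p hp hp2 n hn κ c i (Function.update τ i 1) hd2 hw hw1
  have hgrad := stub_gradientOnPlane p hp n κ c i τ (AlgebraicClosure κ) ĉ ℓ hw hcrit hℓ hci hℓi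
  have hface : ∀ B : Fin n → ℕ, B i = 0 → clean p (step p i τ c) B =
      if (∀ j, p ∣ B j) then 0 else MvPolynomial.coeff (Finsupp.equivFunOnFinite.symm B)
        (MvPolynomial.aeval (fun j : Fin n => if j = i then (1 : MvPolynomial (Fin n) κ) else
          MvPolynomial.C (τ j) + MvPolynomial.X j) (cone p c)) := by
    intro B hB
    rw [clean_step, stub_faceDictionary p n κ c i τ B hM hB]
  obtain ⟨hvan, hconst⟩ :=
    stub_faceToPlane p hp n κ (step p i τ c) i _ (AlgebraicClosure κ) ĉ ℓ hci hℓi hface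
  have hvan0 : ∀ k : Fin n, k ≠ i →
      MvPowerSeries.subst (fun m : Fin n => MvPowerSeries.C (ĉ m) * MvPowerSeries.X (0 : Fin 2) +
        MvPowerSeries.C (ℓ m) * MvPowerSeries.X 1) (pd k (ser p (step p i τ c))) = 0 := by
    intro k hk
    rw [hvan k hk, hgrad k hk, MvPolynomial.coe_zero]
  have hconst0 : MvPowerSeries.constantCoeff (MvPowerSeries.subst
      (fun m : Fin n => MvPowerSeries.C (ĉ m) * MvPowerSeries.X (0 : Fin 2) +
        MvPowerSeries.C (ℓ m) * MvPowerSeries.X 1) (pd i (ser p (step p i τ c)))) = 0 := by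
    rw [hconst, clean_step, step_single_eq_zero p hp i τ c hM', map_zero]
  exact stub_planeCriterion p n κ (step p i τ c) i (AlgebraicClosure κ) ĉ ℓ j j' hdet hvan0 hconst0 hI'

/-! ## The crux -/

/-- **The one-step cone exit lemma** (crux `ConeExit` of route `WildCones`,
stmt-ResolutionOfSingularities-16883): `p` odd, `n ≥ 3`, `κ` perfect of characteristic `p`; if a state `c`
is isolated of multiplicity `p` and a successor `step i τ c` is isolated of multiplicity `p`, then `c` has
cleaned order exactly `p` and `dL c = 1`. The route decl unfolds onto the mirrored calculus by
`ζ/δ`-reduction (the `show`; cf. `Negative.crux_iff`); Case A gives `OrdP`, the near direction with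
`w i = 1 ≠ 0` gives `1 ≤ dL`, cone forcing gives `dL ≤ 1`. [folklore] -/
theorem ConeExit_proof : ConeExit := by
  intro p hp hp2 n hn κ _ _ _ c i τ
  show Module.Finite κ (MvPowerSeries (Fin n) κ ⧸ jac p c) →
      ((∃ A, clean p c A ≠ 0) ∧ ∀ A, clean p c A ≠ 0 → p ≤ Finset.sum Finset.univ (fun j => A j)) →
      Module.Finite κ (MvPowerSeries (Fin n) κ ⧸ jac p (step p i τ c)) →
      ((∃ A, clean p (step p i τ c) A ≠ 0) ∧
        ∀ A, clean p (step p i τ c) A ≠ 0 → p ≤ Finset.sum Finset.univ (fun j => A j)) →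
      (∃ A, clean p c A ≠ 0 ∧ Finset.sum Finset.univ (fun j => A j) = p) ∧ dL p c = 1
  intro _ hM hI' hM'
  have hO := caseA p hp n hn κ c i τ hM hI' hM'
  have hv : Function.update τ i 1 ∈ Linv p c := nearDirection p hp n κ c i τ hM hM'
  have hv0 : Function.update τ i (1 : κ) ≠ 0 := by
    intro h
    have h1 := congrFun h i
    simp at h1
  exact ⟨hO, le_antisymm (coneForcing p hp hp2 n hn κ c i τ hM hI' hM' hv)
    (one_le_dL_of_mem p hv hv0)⟩

end Summit.ResolutionOfSingularities.ResolutionOfSingularities.Theorems.WildConesConeExit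

end
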